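import Summits.SmoothPoincare4.SmoothPoincare4.Theorems.SullivanDualWitnessChargeHelperMemberFarCovers
import Summits.SmoothPoincare4.SmoothPoincare4.Theorems.SullivanDualWitnessChargeHelperMemberNearBound
import Summits.SmoothPoincare4.SmoothPoincare4.Theorems.SullivanDualWitnessChargeHelperMemberFarDecay
import Summits.SmoothPoincare4.SmoothPoincare4.Theorems.SullivanDualWitnessChargeHelperMemberTailDecay
import Summits.SmoothPoincare4.SmoothPoincare4.Theorems.SullivanDualWitnessChargeHelperEndHolomorphic
import Summits.SmoothPoincare4.SmoothPoincare4.Theorems.SullivanDualWitnessChargeFlatChart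
import Mathlib.Analysis.Complex.Basic

/-!
# Helper `helper_limitBounds` of line `Sketch` for crux `WitnessCharge`
(item stmt-SmoothPoincare4-7824; route `SullivanDual`, crux
`Summit.SmoothPoincare4.SmoothPoincare4.Theses.SullivanDual.WitnessCharge`; line `Sketch`,
registered stub `helper_limitBounds` of the lead's cycle-2 helper skeleton, wave 3 —
(N)-branch: the uniform bounds of pencil members pass to a pointwise limit)

**The uniform bounds pass to the limit.** Let `J` be STANDARD on the punctured `ε'`-chart-ball
`B_{ε'}` at `p` (closed `ε'`-ball inside the chart target), let `u n` be pencil members of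
intercepts `b n` with `‖b n‖ ≤ B` and `b n → b⋆`, and let `G : ℂ → Σ∖p` be a pointwise limit of the
subsequence `u (φ k)`. Fix `R > ε'⁻¹` and assume (output of the neighbouring stub
`helper_limitFar`) that for `2R < ‖ξ‖` the limit point `G ξ` lies in `B_{ε'}` and the flat
coordinates converge: `Ycoord p (u (φ k) ξ) → Ycoord p (G ξ)`. Writing `(z⋆, w⋆) = Ycoord p (G ξ)`:

* DECAY: `‖z⋆ − ξ‖ ≤ 48 R² / ‖ξ‖` for `‖ξ‖ ≥ 4R` — the member bound `helper_memberFarDecay_of`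
  (fed with `helper_memberFarCovers`, `helper_memberNearBound_of`) passed to the limit;
* TAIL: `‖w⋆ − b⋆‖ ≤ 4 · max ε'⁻¹ B · R / ‖z⋆‖` for `2R < ‖ξ‖` — for every member,
  `helper_memberFarCovers` puts `u (φ k) ξ` in `B_{ε'}` with `R < ‖z_k‖`, and the tail bound
  `‖w_k − b (φ k)‖ ≤ 4 · max ε'⁻¹ ‖b (φ k)‖ · R / ‖z_k‖` holds as soon as `R < ‖z_k‖`
  (`memberTailDecay_of_lt` below: the proof of `helper_memberTailDecay` — Schwarz lemma at infinity
  `stub_exteriorSchwarz` for the graph function minus `b` — run with the radii `R < min ‖z_k‖ (2R)`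
  instead of `R < 2R`); then `max ε'⁻¹ ‖b (φ k)‖ ≤ max ε'⁻¹ B`, `‖z⋆‖ ≥ R > 0`, and both sides
  converge;
* NEAR: `‖z⋆‖ ≤ 2r` for `r ≥ 2R`, `‖ξ‖ ≤ r`, `G ξ ∈ B_{ε'}` — `B_{ε'}` is open and `Ycoord p` is
  continuous on it (`contMDiffAt_Ycoord`), so eventually `u (φ k) ξ ∈ B_{ε'}` where
  `helper_memberNearBound_of` gives `‖z_k‖ ≤ 2r`, and `z_k → z⋆`.
-/

noncomputable section

-- the registered namespace `Summit.SmoothPoincare4.SmoothPoincare4.…` repeats a component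
set_option linter.dupNamespace false

open scoped Manifold ContDiff Topology
open Set Filter Literature.Geometry.Kaehler Literature.Geometry.Symplectic
  Literature.Topology.FourManifolds
open Summit.SmoothPoincare4.SmoothPoincare4.Cruxes.TameOrBrodyR4.Sketch

namespace Summit.SmoothPoincare4.SmoothPoincare4.Theorems.WitnessCharge.PencilIncompleteness

/-! ### The tail bound of a member on the whole graph region `{R < ‖z‖}` -/

/-- **Tail decay of a pencil member on the whole graph region.** For `J` standard on the punctured
`ε'`-chart-ball at `p` (closed `ε'`-ball inside the chart target), a pencil member `u` of intercept
`b`, `R > ε'⁻¹`, and a parameter `ξ` with `u ξ ∈ B_{ε'}` and `R < ‖(Ycoord p (u ξ)).1‖` (strict,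
radius `R` — not `2R` as in `helper_memberTailDecay`):
`‖(Ycoord p (u ξ)).2 − b‖ ≤ 4 · max ε'⁻¹ ‖b‖ · R / ‖(Ycoord p (u ξ)).1‖`. Same proof as
`helper_memberTailDecay` (graph function `h` over `{R < ‖z‖}` from `helper_memberGraph`,
`helper_memberGraphFunction`; `h − b` is holomorphic, bounded by `2 max ε'⁻¹ ‖b‖`, tends to `0`
at infinity), but the Schwarz lemma at infinity `stub_exteriorSchwarz` is applied with the radii
`R < R₂ := min ‖z‖ (2R) ≤ ‖z‖`, giving `‖h z − b‖ ≤ 2 max ε'⁻¹ ‖b‖ · R₂ / ‖z‖ ≤ 4 max ε'⁻¹ ‖b‖ · R / ‖z‖`. -/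
theorem memberTailDecay_of_lt :
    ∀ (S : HomotopySphere 4) (p : S.carrier)
      (J : ∀ x : punctured p, TangentSpace (𝓡 4) x →L[ℝ] TangentSpace (𝓡 4) x) (ε' : ℝ)
      (u : ℂ → punctured p) (b : ℂ),
      0 < ε' →
      Metric.closedBall (extChartAt (𝓡 4) p p) ε' ⊆ (extChartAt (𝓡 4) p).target →
      (∀ x : punctured p, InPuncturedChartBall p ε' x →
        ∀ (v : TangentSpace (𝓡 4) x) (b : EuclideanSpace ℝ (Fin 4)),
          inner ℝ (fderiv ℝ inversion (extChartAt (𝓡 4) p x.1 - extChartAt (𝓡 4) p p)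
            (mfderiv (𝓡 4) 𝓘(ℝ, EuclideanSpace ℝ (Fin 4))
              (fun z : punctured p => extChartAt (𝓡 4) p z.1) x (J x v))) b
          = stdSymplecticForm (fderiv ℝ inversion (extChartAt (𝓡 4) p x.1 - extChartAt (𝓡 4) p p)
            (mfderiv (𝓡 4) 𝓘(ℝ, EuclideanSpace ℝ (Fin 4))
              (fun z : punctured p => extChartAt (𝓡 4) p z.1) x v)) b) →
      IsPencilMember J u b →
      ∀ R : ℝ, ε'⁻¹ < R → ∀ ξ : ℂ, InPuncturedChartBall p ε' (u ξ) →
        R < ‖(Ycoord p (u ξ)).1‖ →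
        ‖(Ycoord p (u ξ)).2 - b‖ ≤ 4 * max ε'⁻¹ ‖b‖ * R / ‖(Ycoord p (u ξ)).1‖ := by
  intro S p J ε' u b hε' hball hJstd hmem R hR ξ hξball hzR
  have hR0 : 0 < R := (inv_pos.2 hε').trans hR
  -- the graph function `h` of the member over `{R < ‖z‖}`
  obtain ⟨hbij, hder⟩ := helper_memberGraph S p J ε' u b hε' hball hJstd hmem R hR
  obtain ⟨h, hhdiff, hgraph, hbound, hlim, -⟩ :=
    helper_memberGraphFunction S p J ε' u b hε' hball hJstd hmem R hR hbij hder
  have hbW : ‖b‖ ≤ max ε'⁻¹ ‖b‖ := le_max_right _ _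
  have hW0 : 0 ≤ max ε'⁻¹ ‖b‖ := (norm_nonneg b).trans hbW
  -- `g = h - b`: holomorphic on `{R < ‖z‖}`, bounded by `2W`, tending to `0` at infinity
  have hgdiff : DifferentiableOn ℂ (fun z : ℂ => h z - b) {c : ℂ | R < ‖c‖} :=
    hhdiff.sub_const b
  have hgbound : ∀ c : ℂ, R < ‖c‖ → ‖h c - b‖ ≤ 2 * max ε'⁻¹ ‖b‖ := fun c hc =>
    calc ‖h c - b‖ ≤ ‖h c‖ + ‖b‖ := norm_sub_le _ _
      _ ≤ max ε'⁻¹ ‖b‖ + max ε'⁻¹ ‖b‖ := add_le_add (hbound c hc) hbW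
      _ = 2 * max ε'⁻¹ ‖b‖ := by ring
  have hgb : ∃ M : ℝ, ∀ c : ℂ, R < ‖c‖ → ‖h c - b‖ ≤ M := ⟨_, hgbound⟩
  have hg0 : Tendsto (fun z : ℂ => h z - b) (cocompact ℂ) (𝓝 0) :=
    tendsto_sub_nhds_zero_iff.2 hlim
  -- the intermediate radius `R₂ = min ‖z‖ (2R)`, `R < R₂ ≤ ‖z‖`, `R₂ ≤ 2R`
  have hR₂ : R < min ‖(Ycoord p (u ξ)).1‖ (2 * R) := lt_min hzR (by linarith)
  have hgL : ∀ c : ℂ, ‖c‖ = min ‖(Ycoord p (u ξ)).1‖ (2 * R) → ‖h c - b‖ ≤ 2 * max ε'⁻¹ ‖b‖ :=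
    fun c hc => hgbound c (by rw [hc]; exact hR₂)
  -- the Schwarz lemma at infinity with radii `R < R₂` and circle bound `2W`, at the point `z`
  have key := stub_exteriorSchwarz (fun z : ℂ => h z - b) R (min ‖(Ycoord p (u ξ)).1‖ (2 * R))
    (2 * max ε'⁻¹ ‖b‖) hR0 hR₂ hgdiff hgb hg0 hgL (Ycoord p (u ξ)).1 (min_le_left _ _)
  -- transport to the member through the graph identity at `z = (Ycoord p (u ξ)).1`
  rw [hgraph ξ hξball hzR] at key
  calc ‖(Ycoord p (u ξ)).2 - b‖
        ≤ 2 * max ε'⁻¹ ‖b‖ * min ‖(Ycoord p (u ξ)).1‖ (2 * R) / ‖(Ycoord p (u ξ)).1‖ := key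
    _ ≤ 2 * max ε'⁻¹ ‖b‖ * (2 * R) / ‖(Ycoord p (u ξ)).1‖ :=
        div_le_div_of_nonneg_right
          (mul_le_mul_of_nonneg_left (min_le_right _ _) (by positivity)) (norm_nonneg _)
    _ = 4 * max ε'⁻¹ ‖b‖ * R / ‖(Ycoord p (u ξ)).1‖ := by ring

/-! ### The helper -/

/-- **The uniform bounds pass to the limit (registered stub `helper_limitBounds`, (N)-branch).**
For `J` standard on the punctured `ε'`-chart-ball at `p` (closed `ε'`-ball inside the chart target),
pencil members `u n` of intercepts `b n` with `‖b n‖ ≤ B`, `b → b⋆`, a pointwise limit `G` of the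
subsequence `u ∘ φ`, and `R > ε'⁻¹` such that for `2R < ‖ξ‖` the point `G ξ` lies in `B_{ε'}` with
`Ycoord p (u (φ k) ξ) → Ycoord p (G ξ)`: (DECAY) `‖(Ycoord p (G ξ)).1 − ξ‖ ≤ 48 R²/‖ξ‖` for
`‖ξ‖ ≥ 4R`; (TAIL) `‖(Ycoord p (G ξ)).2 − b⋆‖ ≤ 4 · max ε'⁻¹ B · R / ‖(Ycoord p (G ξ)).1‖` for
`2R < ‖ξ‖`; (NEAR) `‖(Ycoord p (G ξ)).1‖ ≤ 2r` for `r ≥ 2R`, `‖ξ‖ ≤ r`, `G ξ ∈ B_{ε'}`. Each is the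
corresponding member-uniform bound (`helper_memberFarDecay_of`, `memberTailDecay_of_lt` with
`helper_memberFarCovers`, `helper_memberNearBound_of`) passed to the limit along `k → ∞`; for NEAR
the punctured chart-ball is open and `Ycoord p` is continuous on it, so the flat coordinates of
`u (φ k) ξ → G ξ` converge and `u (φ k) ξ ∈ B_{ε'}` eventually. -/
theorem helper_limitBounds :
    ∀ (S : HomotopySphere 4) (p : S.carrier)
      (J : ∀ x : punctured p, TangentSpace (𝓡 4) x →L[ℝ] TangentSpace (𝓡 4) x) (ε' : ℝ),
      0 < ε' →
      Metric.closedBall (extChartAt (𝓡 4) p p) ε' ⊆ (extChartAt (𝓡 4) p).target →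
      (∀ x : punctured p, InPuncturedChartBall p ε' x →
        ∀ (v : TangentSpace (𝓡 4) x) (b : EuclideanSpace ℝ (Fin 4)),
          inner ℝ (fderiv ℝ inversion (extChartAt (𝓡 4) p x.1 - extChartAt (𝓡 4) p p)
            (mfderiv (𝓡 4) 𝓘(ℝ, EuclideanSpace ℝ (Fin 4))
              (fun z : punctured p => extChartAt (𝓡 4) p z.1) x (J x v))) b
          = stdSymplecticForm (fderiv ℝ inversion (extChartAt (𝓡 4) p x.1 - extChartAt (𝓡 4) p p)
            (mfderiv (𝓡 4) 𝓘(ℝ, EuclideanSpace ℝ (Fin 4))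
              (fun z : punctured p => extChartAt (𝓡 4) p z.1) x v)) b) →
      ∀ (u : ℕ → ℂ → punctured p) (b : ℕ → ℂ) (bstar : ℂ) (B : ℝ) (G : ℂ → punctured p)
        (φ : ℕ → ℕ), StrictMono φ →
        (∀ n, IsPencilMember J (u n) (b n)) → (∀ n, ‖b n‖ ≤ B) → Tendsto b atTop (𝓝 bstar) →
        (∀ ξ : ℂ, Tendsto (fun k => u (φ k) ξ) atTop (𝓝 (G ξ))) →
        ∀ R : ℝ, ε'⁻¹ < R →
        (∀ ξ : ℂ, 2 * R < ‖ξ‖ → InPuncturedChartBall p ε' (G ξ) ∧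
          Tendsto (fun k => Ycoord p (u (φ k) ξ)) atTop (𝓝 (Ycoord p (G ξ)))) →
        (∀ ξ : ℂ, 4 * R ≤ ‖ξ‖ → ‖(Ycoord p (G ξ)).1 - ξ‖ ≤ 48 * R ^ 2 / ‖ξ‖) ∧
        (∀ ξ : ℂ, 2 * R < ‖ξ‖ →
          ‖(Ycoord p (G ξ)).2 - bstar‖ ≤ 4 * max ε'⁻¹ B * R / ‖(Ycoord p (G ξ)).1‖) ∧
        (∀ r : ℝ, 2 * R ≤ r → ∀ ξ : ℂ, ‖ξ‖ ≤ r → InPuncturedChartBall p ε' (G ξ) →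
          ‖(Ycoord p (G ξ)).1‖ ≤ 2 * r) := by
  intro S p J ε' hε' hball hJstd u b bstar B G φ hφ hu hB hblim hpt R hR hfar
  have hR0 : 0 < R := (inv_pos.2 hε').trans hR
  refine ⟨fun ξ hξ => ?_, fun ξ hξ => ?_, fun r hr ξ hξ hGball => ?_⟩
  · -- DECAY: the member bound `helper_memberFarDecay_of` passed to the limit
    have hξ2 : 2 * R < ‖ξ‖ := by linarith
    have hT : Tendsto (fun k => ‖(Ycoord p (u (φ k) ξ)).1 - ξ‖) atTop
        (𝓝 ‖(Ycoord p (G ξ)).1 - ξ‖) :=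
      ((hfar ξ hξ2).2.fst_nhds.sub_const ξ).norm
    exact le_of_tendsto' hT fun k =>
      helper_memberFarDecay_of helper_memberFarCovers
        (helper_memberNearBound_of helper_memberFarCovers) S p J ε' (u (φ k)) (b (φ k)) hε' hball
        hJstd (hu (φ k)) R hR ξ hξ
  · -- TAIL: `memberTailDecay_of_lt` on the graph region (`helper_memberFarCovers`), then the limit
    have hT := (hfar ξ hξ).2
    have hmemb : ∀ k : ℕ, R < ‖(Ycoord p (u (φ k) ξ)).1‖ ∧
        ‖(Ycoord p (u (φ k) ξ)).2 - b (φ k)‖ ≤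
          4 * max ε'⁻¹ B * R / ‖(Ycoord p (u (φ k) ξ)).1‖ := by
      intro k
      obtain ⟨hkball, hkR⟩ :=
        helper_memberFarCovers S p J ε' (u (φ k)) (b (φ k)) hε' hball hJstd (hu (φ k)) R hR ξ hξ
      refine ⟨hkR, (memberTailDecay_of_lt S p J ε' (u (φ k)) (b (φ k)) hε' hball hJstd (hu (φ k))
        R hR ξ hkball hkR).trans ?_⟩
      have hmax : max ε'⁻¹ ‖b (φ k)‖ ≤ max ε'⁻¹ B := max_le_max le_rfl (hB (φ k))
      exact div_le_div_of_nonneg_right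
        (mul_le_mul_of_nonneg_right (mul_le_mul_of_nonneg_left hmax (by norm_num)) hR0.le)
        (norm_nonneg _)
    have hzlim : Tendsto (fun k => ‖(Ycoord p (u (φ k) ξ)).1‖) atTop (𝓝 ‖(Ycoord p (G ξ)).1‖) :=
      hT.fst_nhds.norm
    have hwlim : Tendsto (fun k => ‖(Ycoord p (u (φ k) ξ)).2 - b (φ k)‖) atTop
        (𝓝 ‖(Ycoord p (G ξ)).2 - bstar‖) :=
      (hT.snd_nhds.sub (hblim.comp hφ.tendsto_atTop)).norm
    have hzstar : R ≤ ‖(Ycoord p (G ξ)).1‖ := ge_of_tendsto' hzlim fun k => (hmemb k).1.le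
    have hzne : ‖(Ycoord p (G ξ)).1‖ ≠ 0 := (hR0.trans_le hzstar).ne'
    have hrhs : Tendsto (fun k => 4 * max ε'⁻¹ B * R / ‖(Ycoord p (u (φ k) ξ)).1‖) atTop
        (𝓝 (4 * max ε'⁻¹ B * R / ‖(Ycoord p (G ξ)).1‖)) :=
      tendsto_const_nhds.div hzlim hzne
    exact le_of_tendsto_of_tendsto' hwlim hrhs fun k => (hmemb k).2
  · -- NEAR: eventually `u (φ k) ξ ∈ B_{ε'}` (open), `helper_memberNearBound_of`, then the limit
    have hO : IsOpen {x : punctured p | InPuncturedChartBall p ε' x} :=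
      (gromov_recognitionR4_relEnd.isOpen_chartBall p ε').preimage continuous_subtype_val
    have hev : ∀ᶠ k in atTop, InPuncturedChartBall p ε' (u (φ k) ξ) :=
      hpt ξ (hO.mem_nhds hGball)
    have hT : Tendsto (fun k => Ycoord p (u (φ k) ξ)) atTop (𝓝 (Ycoord p (G ξ))) :=
      (contMDiffAt_Ycoord hGball).continuousAt.tendsto.comp (hpt ξ)
    refine le_of_tendsto hT.fst_nhds.norm ?_
    filter_upwards [hev] with k hk
    exact helper_memberNearBound_of helper_memberFarCovers S p J ε' (u (φ k)) (b (φ k)) hε' hball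
      hJstd (hu (φ k)) R hR r hr ξ hξ hk

end Summit.SmoothPoincare4.SmoothPoincare4.Theorems.WitnessCharge.PencilIncompleteness
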